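import Summits.BirchSwinnertonDyer.Rank1Residual.P2.KrizLiStarFields
import Summits.BirchSwinnertonDyer.Rank1Residual.P2.KrizLiTwistMinimalModelsGoodBases
import Mathlib.Tactic.NormNum.LegendreSymbol
import HarnessLib

/-!
# Cell `bsd-print-cf2` (D-0131 (2) PRINT TIER, leaf CornerF @ `p = 2`), seat ty2 — EXPLICIT Kriz–Li members that
# are reached ONLY through a COMPOSITE certified Heegner field: `1323a1^{(997)}`, `1323m1^{(997)}` over
# `ℚ(√−215)` and `4563a1^{(4561)}` over `ℚ(√−95)`, decided in the kernel, `BSD(·, 2)` BY NAME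

HONEST FRAMING (cell `bsd-print-cf2`, run/shared/lean/pub/bsd-print-cf2/; verbatim): PARTITION currency
only — the leaf counts when its class theorem is in the kernel BY NAME; every imported theorem carries its
printed hypotheses verbatim. The leaf is OPEN AS A CLASS; theorems only, no definition, no named fact.

End-to-end check of the composite-`D` interface (`KrizLiStarFields.lean` + `Literature…
HeegnerFieldOfDiscriminantProofs.lean`) at members where it is NEEDED. For a (★)-base `E` the index set
`𝒩(E, K)` of Kriz–Li Def. 4.1 depends on the Heegner field `K` through "`ℓ` split in `K`"; the cell's certified
fields for `1323a1`/`1323m1` are `D ∈ {−47, −215, −479, −503, −551}` and for `4563a1` they are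
`D ∈ {−23, −95, −191, −263, −287, −311, −407, −503, −599, −623}` (lit g5, `|D| ≤ 800`, complete). The prime
`ℓ = 997` (`≡ 1 (mod 12)`, `a₉₉₇` odd at both `1323` bases) is INERT in `ℚ(√−47)`, `ℚ(√−479)`, `ℚ(√−503)`,
`ℚ(√−551)` and SPLIT in `ℚ(√−215)` (`−215 = −5·43`); the prime `ℓ = 4561` (`a₄₅₆₁(4563a1)` odd) is inert in
all six PRIME certified fields of `4563a1` (and in `ℚ(√−407)`) and split in `ℚ(√−95)` (also in `ℚ(√−287)`,
`ℚ(√−623)`). Hence the rank-one leaf members `1323a1^{(997)}`, `1323m1^{(997)}`, `4563a1^{(4561)}` get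
`BSD(·, 2)` by name from the Kriz–Li door ONLY via a composite-`D` (★)-certificate — the case the tree could not
state before this seat's `d_K(ℚ(√D)) = D` lemma. Per member: `d ∈ 𝒩(E, ℚ(√D))` DECIDED (`decide +kernel` on the
cube-root count in `𝔽_ℓ`, `norm_num` on the Kronecker symbols), `¬ ℓ ∈ 𝒮(E, K)` for the other certified `d_K`
(PROVED, K-generic), `BSD(W′, 2)` for every globally minimal `W′` `ℚ`-isogenous to `E^{(d)}` or `E^{(D·d)}`, and
the member ON THE NOSE as g5's minimal model `cubicA₃ k` (`4k + 1 = d³·t`): `y² + y = x³ + 594863940543`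
(`1323a1^{(997)}`), `y² + y = x³ − 1734297203` (`1323m1^{(997)}`), `y² + y = x³ + 8807182320780483`
(`4563a1^{(4561)}`), each with `ord_{s=1} L = 1 ∧ BSD(·, 2)` granted BY NAME the seven facts of aside 21366 and
the DISPLAYED (★)-datum `hSD : HasKrizLiStarDatum E (sqrtField D)` (lit g5 certificate: `(1323a1, −215)`:
`P_K` exact, `I = 1`… see HOME/lit/census-g5/STARCERT-TABLE.md). Currency LITERAL-by-name((★)-certificate).
beyond-print theorem: NO. [cite: KrizLi2019, Thm. 1.12 (FMS Thm. 5.1 (2)), Thm. 4.3, Def. 4.1, §6 Ex. 6.2]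

References: [KrizLi2019]; [Marcus2018] Ch. 2 Thm. 1, Ch. 3 Thm. 25; [CreutzMiller2012] Thm 1.1;
[BurungaleFlach2024] Cor 2; [MilneADT2006] Thm I.7.3; HOME/lit/census-g5/STARCERT-TABLE.md.
-/

noncomputable section

open scoped Classical

open WeierstrassCurve NumberField Literature.NumberTheory.EllipticCurves
  Literature.NumberTheory.EllipticCurves.Rank1Residual
  Literature.NumberTheory.EllipticCurves.ModularForms
  Summit.BirchSwinnertonDyer.Rank1Residual

set_option autoImplicit false

namespace Summit.BirchSwinnertonDyer.Rank1Residual.P2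

/-! ## §1 `1323a1` over `ℚ(√−215)`: `d = 997` -/

/-- **`997 ∈ 𝒩(1323a1, ℚ(√−215))`**, decided in the kernel: `997` prime, `≡ 1 (mod 4)`, `∉ {2, 3, 7}`,
`(−215/997) = 1`, and `x³ = −16·2401` has no root in `𝔽₉₉₇`. [cite: KrizLi2019, Def. 4.1 (FMS) = arXiv Def. 3.1] -/
theorem inN_997_curve1323a1_neg215 :
    haveI : Fact ((-215 : ℤ) < 0) := ⟨by norm_num⟩
    KrizLi2019.InN curve1323a1 (sqrtField (-215)) 997 := by
  haveI : Fact ((-215 : ℤ) < 0) := ⟨by norm_num⟩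
  refine inN_curve1323a1_of_discr_eq (sqrtField.finrank_eq_two (-215))
    (discr_sqrtField (-215) (by norm_num) (Int.squarefree_natAbs.mp (by decide +kernel))) (d := 997)
    (by norm_num) (by exact (Nat.prime_iff.1 (by norm_num)).squarefree) (fun ℓ hℓ hℓd => ?_)
  have h : ℓ ∣ 997 := by simpa using hℓd
  obtain rfl := (Nat.prime_dvd_prime_iff_eq hℓ (by norm_num)).mp h
  have key : Even ((Finset.univ.filter fun x : ZMod 997 =>
      x ^ 3 = -(16 * (4 * (600 : ZMod 997) + 1))).card) := by decide +kernel
  exact ⟨by norm_num, by norm_num, by norm_num, by norm_num, key⟩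

/-- **`997 ∉ 𝒮(1323a1, K)` for every OTHER certified Heegner field of `1323a1`** (`d_K ∈ {−47, −479, −503, −551}`):
`997` is inert there (`(d_K/997) = −1`). So no certificate at a prime `|d_K|` reaches the member `1323a1^{(997)}`.
[cite: KrizLi2019, Def. 4.1 (FMS)] [cite: Marcus2018, Ch. 3 Thm. 25] -/
theorem not_inS_997_curve1323a1_of_discr_eq {K : Type} [Field K] [NumberField K] (h2 : Module.finrank ℚ K = 2)
    (hdK : NumberField.discr K = -47 ∨ NumberField.discr K = -479 ∨ NumberField.discr K = -503 ∨
      NumberField.discr K = -551) : ¬ KrizLi2019.InS curve1323a1 K 997 := by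
  rintro ⟨hℓ, -, hsplit, -⟩
  have hj := (Literature.NumberTheory.QuadraticFields.Quadratic.ncard_primesOver_eq_two_iff_jacobiSym h2 hℓ
    (by norm_num)).1 hsplit
  rcases hdK with h | h | h | h <;> rw [h] at hj <;> norm_num at hj

/-- **`BSD(W′, 2)` for every globally minimal `W′` `ℚ`-isogenous to `1323a1^{(997)}` or `1323a1^{(−215·997)}`**,
granted BY NAME the seven facts and the DISPLAYED (★)-datum of `(1323a1, ℚ(√−215))`.
[cite: KrizLi2019, Thm. 5.1 (2), Def. 4.1, §6 Ex. 6.2] [cite: CreutzMiller2012, Thm. 1.1]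
[cite: BurungaleFlach2024, Thm. 1.1 and Cor. 2] [cite: MilneADT2006, Thm. I.7.3] -/
theorem bsdp_two_twist_997_curve1323a1_neg215 (hKL : KrizLi2019.thm112_bsdTwo_twist)
    (h33 : KrizLi2019.thm33_rank_twist) (hS31 : bsdTriple_of_analyticRank_le_one_of_conductor_lt)
    (hBF : bsdTriple_of_hasCM_of_L_one_ne_zero) (hmod : hasEntireLFunction_rat)
    (hGZK : rank_eq_analyticRank_of_analyticRank_le_one) (hCassels : bsdRHS_eq_of_isIsogenous)
    (hSD : haveI : Fact ((-215 : ℤ) < 0) := ⟨by norm_num⟩; HasKrizLiStarDatum curve1323a1 (sqrtField (-215)))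
    (W' : WeierstrassCurve ℚ) [W'.IsElliptic] [W'.IsGloballyMinimal]
    (hiso : IsIsogenous W' (curve1323a1.quadraticTwist ((997 : ℤ) : ℚ)) ∨
      IsIsogenous W' (curve1323a1.quadraticTwist ((-215 * 997 : ℤ) : ℚ))) : BSDp W' 2 :=
  haveI : Fact ((-215 : ℤ) < 0) := ⟨by norm_num⟩
  bsdp_two_of_isIsogenous_twist_curve1323a1_sqrtField hKL h33 hS31 hBF hmod hGZK hCassels (D := -215)
    (by norm_num) (by decide +kernel) (by norm_num) (by norm_num) hSD inN_997_curve1323a1_neg215 (by norm_num)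
    (by norm_num) (by norm_num) W' hiso

/-- **`y² + y = x³ + 594863940543 = 1323a1^{(997)}`** (`4·594863940543 + 1 = 997³·7⁴`): globally minimal,
`ord_{s=1} L = 1 ∧ BSD(·, 2)` BY NAME (seven facts + the displayed (★)-datum of `(1323a1, ℚ(√−215))`).
[cite: KrizLi2019, Thm. 5.1 (2), Thm. 4.3, Def. 4.1, §6 Ex. 6.2] [cite: CreutzMiller2012, Thm. 1.1]
[cite: BurungaleFlach2024, Thm. 1.1 and Cor. 2] [cite: MilneADT2006, Thm. I.7.3] -/
theorem analyticRank_eq_one_and_bsdp_two_twistModel_997_curve1323a1 (hKL : KrizLi2019.thm112_bsdTwo_twist)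
    (h33 : KrizLi2019.thm33_rank_twist) (hS31 : bsdTriple_of_analyticRank_le_one_of_conductor_lt)
    (hBF : bsdTriple_of_hasCM_of_L_one_ne_zero) (hmod : hasEntireLFunction_rat)
    (hGZK : rank_eq_analyticRank_of_analyticRank_le_one) (hCassels : bsdRHS_eq_of_isIsogenous)
    (hSD : haveI : Fact ((-215 : ℤ) < 0) := ⟨by norm_num⟩; HasKrizLiStarDatum curve1323a1 (sqrtField (-215))) :
    ∃ _ : (cubicA₃ 594863940543).IsGloballyMinimal,
      (cubicA₃ 594863940543).analyticRank = 1 ∧ BSDp (cubicA₃ 594863940543) 2 := by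
  haveI : Fact ((-215 : ℤ) < 0) := ⟨by norm_num⟩
  obtain ⟨hK, hdK⟩ := isImaginaryQuadratic_and_discr_sqrtField_of_squarefree_natAbs (-215) (by norm_num)
    (by decide +kernel)
  exact analyticRank_eq_one_and_bsdp_two_twistModel_curve1323a1 hKL h33 hS31 hBF hmod hGZK hCassels hK
    (by rw [hdK]; norm_num) (by rw [hdK]; norm_num) hSD (d := 997) (by norm_num) inN_997_curve1323a1_neg215
    (by norm_num) (by norm_num) (by norm_num)

/-! ## §2 `1323m1` over `ℚ(√−215)`: `d = 997` -/

/-- **`997 ∈ 𝒩(1323m1, ℚ(√−215))`**, decided in the kernel (`x³ = 112` has no root in `𝔽₉₉₇`).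
[cite: KrizLi2019, Def. 4.1 (FMS) = arXiv Def. 3.1] -/
theorem inN_997_curve1323m1_neg215 :
    haveI : Fact ((-215 : ℤ) < 0) := ⟨by norm_num⟩
    KrizLi2019.InN curve1323m1 (sqrtField (-215)) 997 := by
  haveI : Fact ((-215 : ℤ) < 0) := ⟨by norm_num⟩
  refine inN_curve1323m1_of_discr_eq (sqrtField.finrank_eq_two (-215))
    (discr_sqrtField (-215) (by norm_num) (Int.squarefree_natAbs.mp (by decide +kernel))) (d := 997)
    (by norm_num) (by exact (Nat.prime_iff.1 (by norm_num)).squarefree) (fun ℓ hℓ hℓd => ?_)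
  have h : ℓ ∣ 997 := by simpa using hℓd
  obtain rfl := (Nat.prime_dvd_prime_iff_eq hℓ (by norm_num)).mp h
  have key : Even ((Finset.univ.filter fun x : ZMod 997 =>
      x ^ 3 = -(16 * (4 * (-2 : ZMod 997) + 1))).card) := by decide +kernel
  exact ⟨by norm_num, by norm_num, by norm_num, by norm_num, key⟩

/-- **`997 ∉ 𝒮(1323m1, K)` for `d_K ∈ {−47, −479, −503, −551}`** (inert). [cite: KrizLi2019, Def. 4.1 (FMS)]
[cite: Marcus2018, Ch. 3 Thm. 25] -/
theorem not_inS_997_curve1323m1_of_discr_eq {K : Type} [Field K] [NumberField K] (h2 : Module.finrank ℚ K = 2)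
    (hdK : NumberField.discr K = -47 ∨ NumberField.discr K = -479 ∨ NumberField.discr K = -503 ∨
      NumberField.discr K = -551) : ¬ KrizLi2019.InS curve1323m1 K 997 := by
  rintro ⟨hℓ, -, hsplit, -⟩
  have hj := (Literature.NumberTheory.QuadraticFields.Quadratic.ncard_primesOver_eq_two_iff_jacobiSym h2 hℓ
    (by norm_num)).1 hsplit
  rcases hdK with h | h | h | h <;> rw [h] at hj <;> norm_num at hj

/-- **`BSD(W′, 2)` for every globally minimal `W′` `ℚ`-isogenous to `1323m1^{(997)}` or `1323m1^{(−215·997)}`.**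
[cite: KrizLi2019, Thm. 5.1 (2), Def. 4.1, §6 Ex. 6.2] [cite: CreutzMiller2012, Thm. 1.1]
[cite: BurungaleFlach2024, Thm. 1.1 and Cor. 2] [cite: MilneADT2006, Thm. I.7.3] -/
theorem bsdp_two_twist_997_curve1323m1_neg215 (hKL : KrizLi2019.thm112_bsdTwo_twist)
    (h33 : KrizLi2019.thm33_rank_twist) (hS31 : bsdTriple_of_analyticRank_le_one_of_conductor_lt)
    (hBF : bsdTriple_of_hasCM_of_L_one_ne_zero) (hmod : hasEntireLFunction_rat)
    (hGZK : rank_eq_analyticRank_of_analyticRank_le_one) (hCassels : bsdRHS_eq_of_isIsogenous)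
    (hSD : haveI : Fact ((-215 : ℤ) < 0) := ⟨by norm_num⟩; HasKrizLiStarDatum curve1323m1 (sqrtField (-215)))
    (W' : WeierstrassCurve ℚ) [W'.IsElliptic] [W'.IsGloballyMinimal]
    (hiso : IsIsogenous W' (curve1323m1.quadraticTwist ((997 : ℤ) : ℚ)) ∨
      IsIsogenous W' (curve1323m1.quadraticTwist ((-215 * 997 : ℤ) : ℚ))) : BSDp W' 2 :=
  haveI : Fact ((-215 : ℤ) < 0) := ⟨by norm_num⟩
  bsdp_two_of_isIsogenous_twist_curve1323m1_sqrtField hKL h33 hS31 hBF hmod hGZK hCassels (D := -215)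
    (by norm_num) (by decide +kernel) (by norm_num) (by norm_num) hSD inN_997_curve1323m1_neg215 (by norm_num)
    (by norm_num) (by norm_num) W' hiso

/-- **`y² + y = x³ − 1734297203 = 1323m1^{(997)}`** (`4·(−1734297203) + 1 = −7·997³`): globally minimal,
`ord_{s=1} L = 1 ∧ BSD(·, 2)` BY NAME. [cite: KrizLi2019, Thm. 5.1 (2), Thm. 4.3, Def. 4.1, §6 Ex. 6.2]
[cite: CreutzMiller2012, Thm. 1.1] [cite: BurungaleFlach2024, Thm. 1.1 and Cor. 2] [cite: MilneADT2006, Thm. I.7.3] -/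
theorem analyticRank_eq_one_and_bsdp_two_twistModel_997_curve1323m1 (hKL : KrizLi2019.thm112_bsdTwo_twist)
    (h33 : KrizLi2019.thm33_rank_twist) (hS31 : bsdTriple_of_analyticRank_le_one_of_conductor_lt)
    (hBF : bsdTriple_of_hasCM_of_L_one_ne_zero) (hmod : hasEntireLFunction_rat)
    (hGZK : rank_eq_analyticRank_of_analyticRank_le_one) (hCassels : bsdRHS_eq_of_isIsogenous)
    (hSD : haveI : Fact ((-215 : ℤ) < 0) := ⟨by norm_num⟩; HasKrizLiStarDatum curve1323m1 (sqrtField (-215))) :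
    ∃ _ : (cubicA₃ (-1734297203)).IsGloballyMinimal,
      (cubicA₃ (-1734297203)).analyticRank = 1 ∧ BSDp (cubicA₃ (-1734297203)) 2 := by
  haveI : Fact ((-215 : ℤ) < 0) := ⟨by norm_num⟩
  obtain ⟨hK, hdK⟩ := isImaginaryQuadratic_and_discr_sqrtField_of_squarefree_natAbs (-215) (by norm_num)
    (by decide +kernel)
  exact analyticRank_eq_one_and_bsdp_two_twistModel_curve1323m1 hKL h33 hS31 hBF hmod hGZK hCassels hK
    (by rw [hdK]; norm_num) (by rw [hdK]; norm_num) hSD (d := 997) (by norm_num) inN_997_curve1323m1_neg215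
    (by norm_num) (by norm_num) (by norm_num)

/-! ## §3 `4563a1` over `ℚ(√−95)`: `d = 4561` -/

/-- **`4561 ∈ 𝒩(4563a1, ℚ(√−95))`**, decided in the kernel: `4561` prime, `≡ 1 (mod 4)`, `∉ {2, 3, 13}`,
`(−95/4561) = 1`, and `x³ = −16·13⁵` has no root in `𝔽₄₅₆₁`. [cite: KrizLi2019, Def. 4.1 (FMS) = arXiv Def. 3.1] -/
theorem inN_4561_curve4563a1_neg95 :
    haveI : Fact ((-95 : ℤ) < 0) := ⟨by norm_num⟩
    KrizLi2019.InN curve4563a1 (sqrtField (-95)) 4561 := by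
  haveI : Fact ((-95 : ℤ) < 0) := ⟨by norm_num⟩
  refine inN_curve4563a1_of_discr_eq (sqrtField.finrank_eq_two (-95))
    (discr_sqrtField (-95) (by norm_num) (Int.squarefree_natAbs.mp (by decide +kernel))) (d := 4561)
    (by norm_num) (by exact (Nat.prime_iff.1 (by norm_num)).squarefree) (fun ℓ hℓ hℓd => ?_)
  have h : ℓ ∣ 4561 := by simpa using hℓd
  obtain rfl := (Nat.prime_dvd_prime_iff_eq hℓ (by norm_num)).mp h
  have key : Even ((Finset.univ.filter fun x : ZMod 4561 =>
      x ^ 3 = -(16 * (4 * (92823 : ZMod 4561) + 1))).card) := by decide +kernel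
  exact ⟨by norm_num, by norm_num, by norm_num, by norm_num, key⟩

/-- **`4561 ∉ 𝒮(4563a1, K)` for every certified Heegner field of `4563a1` with PRIME `|d_K|`**
(`d_K ∈ {−23, −191, −263, −311, −503, −599}`) and for `d_K = −407`: `4561` is inert there. So the member
`4563a1^{(4561)}` is reached only through the composite certificates `−95`, `−287`, `−623`.
[cite: KrizLi2019, Def. 4.1 (FMS)] [cite: Marcus2018, Ch. 3 Thm. 25] -/
theorem not_inS_4561_curve4563a1_of_discr_eq {K : Type} [Field K] [NumberField K] (h2 : Module.finrank ℚ K = 2)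
    (hdK : NumberField.discr K = -23 ∨ NumberField.discr K = -191 ∨ NumberField.discr K = -263 ∨
      NumberField.discr K = -311 ∨ NumberField.discr K = -503 ∨ NumberField.discr K = -599 ∨
      NumberField.discr K = -407) : ¬ KrizLi2019.InS curve4563a1 K 4561 := by
  rintro ⟨hℓ, -, hsplit, -⟩
  have hj := (Literature.NumberTheory.QuadraticFields.Quadratic.ncard_primesOver_eq_two_iff_jacobiSym h2 hℓ
    (by norm_num)).1 hsplit
  rcases hdK with h | h | h | h | h | h | h <;> rw [h] at hj <;> norm_num at hj

/-- **`BSD(W′, 2)` for every globally minimal `W′` `ℚ`-isogenous to `4563a1^{(4561)}` or `4563a1^{(−95·4561)}`**,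
granted BY NAME the seven facts and the DISPLAYED (★)-datum of `(4563a1, ℚ(√−95))`.
[cite: KrizLi2019, Thm. 5.1 (2), Def. 4.1, §6 Ex. 6.2] [cite: CreutzMiller2012, Thm. 1.1]
[cite: BurungaleFlach2024, Thm. 1.1 and Cor. 2] [cite: MilneADT2006, Thm. I.7.3] -/
theorem bsdp_two_twist_4561_curve4563a1_neg95 (hKL : KrizLi2019.thm112_bsdTwo_twist)
    (h33 : KrizLi2019.thm33_rank_twist) (hS31 : bsdTriple_of_analyticRank_le_one_of_conductor_lt)
    (hBF : bsdTriple_of_hasCM_of_L_one_ne_zero) (hmod : hasEntireLFunction_rat)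
    (hGZK : rank_eq_analyticRank_of_analyticRank_le_one) (hCassels : bsdRHS_eq_of_isIsogenous)
    (hSD : haveI : Fact ((-95 : ℤ) < 0) := ⟨by norm_num⟩; HasKrizLiStarDatum curve4563a1 (sqrtField (-95)))
    (W' : WeierstrassCurve ℚ) [W'.IsElliptic] [W'.IsGloballyMinimal]
    (hiso : IsIsogenous W' (curve4563a1.quadraticTwist ((4561 : ℤ) : ℚ)) ∨
      IsIsogenous W' (curve4563a1.quadraticTwist ((-95 * 4561 : ℤ) : ℚ))) : BSDp W' 2 :=
  haveI : Fact ((-95 : ℤ) < 0) := ⟨by norm_num⟩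
  bsdp_two_of_isIsogenous_twist_curve4563a1_sqrtField hKL h33 hS31 hBF hmod hGZK hCassels (D := -95)
    (by norm_num) (by decide +kernel) (by norm_num) (by norm_num) hSD inN_4561_curve4563a1_neg95 (by norm_num)
    (by norm_num) (by norm_num) W' hiso

/-- **`y² + y = x³ + 8807182320780483 = 4563a1^{(4561)}`** (`4·8807182320780483 + 1 = 4561³·13⁵`): globally
minimal, `ord_{s=1} L = 1 ∧ BSD(·, 2)` BY NAME (seven facts + the displayed (★)-datum of `(4563a1, ℚ(√−95))`).
[cite: KrizLi2019, Thm. 5.1 (2), Thm. 4.3, Def. 4.1, §6 Ex. 6.2] [cite: CreutzMiller2012, Thm. 1.1]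
[cite: BurungaleFlach2024, Thm. 1.1 and Cor. 2] [cite: MilneADT2006, Thm. I.7.3] -/
theorem analyticRank_eq_one_and_bsdp_two_twistModel_4561_curve4563a1 (hKL : KrizLi2019.thm112_bsdTwo_twist)
    (h33 : KrizLi2019.thm33_rank_twist) (hS31 : bsdTriple_of_analyticRank_le_one_of_conductor_lt)
    (hBF : bsdTriple_of_hasCM_of_L_one_ne_zero) (hmod : hasEntireLFunction_rat)
    (hGZK : rank_eq_analyticRank_of_analyticRank_le_one) (hCassels : bsdRHS_eq_of_isIsogenous)
    (hSD : haveI : Fact ((-95 : ℤ) < 0) := ⟨by norm_num⟩; HasKrizLiStarDatum curve4563a1 (sqrtField (-95))) :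
    ∃ _ : (cubicA₃ 8807182320780483).IsGloballyMinimal,
      (cubicA₃ 8807182320780483).analyticRank = 1 ∧ BSDp (cubicA₃ 8807182320780483) 2 := by
  haveI : Fact ((-95 : ℤ) < 0) := ⟨by norm_num⟩
  obtain ⟨hK, hdK⟩ := isImaginaryQuadratic_and_discr_sqrtField_of_squarefree_natAbs (-95) (by norm_num)
    (by decide +kernel)
  exact analyticRank_eq_one_and_bsdp_two_twistModel_curve4563a1 hKL h33 hS31 hBF hmod hGZK hCassels hK
    (by rw [hdK]; norm_num) (by rw [hdK]; norm_num) hSD (d := 4561) (by norm_num) inN_4561_curve4563a1_neg95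
    (by norm_num) (by norm_num) (by norm_num)

end Summit.BirchSwinnertonDyer.Rank1Residual.P2

end
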